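import Mathlib
import Summits.Ventures.PercRepro2.RowC1Min

/-!
# The surviving sharpening (E1) of row 2′C1, typed, and its reduction of the row
(blind cell PercRepro2, p2 g28; proofs/P2-G28-C1.md §7)

With `Q = {a₁ ↮ a₂}`, `C_i = C(a_i)`, `U = C₁ ∪ C₂`, `μ = P(· | Q)`:

  **(E1)**  `Cov_μ(1[b ∈ C₂], 1[o ∈ U]) ≥ −μ(b ∈ C₁, o ∈ C₁)`,

cleared by `P(Q)²`: `P(Q, b ∈ C₂)·P(Q, o ∈ U) ≤ P(Q)·(P(Q, b ∈ C₂, o ∈ U) + P(Q, b ∈ C₁, o ∈ C₁))`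
(`E1Cov`).  It lies between the refuted (TRI-COV) (`RowC1.TriCov`, TriCovCounterexample6.lean) and
the row: `TriCov ⟹ E1Cov` is `e1_of_triCov` (RowC1Tri.lean) and **`c1_of_e1`** below is
`E1Cov ⟹ (c1)`, by `P(Q, o ∈ U, b ∈ U) ≥ P(Q, b ∈ C₂, o ∈ U) + P(Q, b ∈ C₁, o ∈ C₁)` (disjoint on `Q`).
(E1) is a CONJECTURE of the cell (2-copy typed-positive at n = 6 on 640 graphs, proofs/P2-G28-C1.md §7),
not a fact.
-/

namespace Summit.Ventures.PercRepro2

namespace RowC1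

section E1

variable {V : Type*} {E : Type*} [Fintype E] [DecidableEq E]
  {R : Type*} [CommRing R] [LinearOrder R] [IsStrictOrderedRing R]

/-- **(E1)**, cleared by `P(Q)²`: `P(Q, b ∈ C₂)·P(Q, o ∈ U) ≤ P(Q)·(P(Q, b ∈ C₂, o ∈ U) + P(Q, b ∈ C₁, o ∈ C₁))`,
i.e. `Cov_μ(1[b ∈ C₂], 1[o ∈ U]) ≥ −μ(b ∈ C₁, o ∈ C₁)` under `μ = P(· | a₁ ↮ a₂)`.  A CONJECTURE (p2 g28). -/
def E1Cov (p : E → R) (ends : E → Sym2 V) (a₁ a₂ o b : V) : Prop :=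
  prob p (connEvent ends a₂ b ∩ (connEvent ends a₁ a₂)ᶜ) *
      prob p ((connEvent ends a₁ o ∪ connEvent ends a₂ o) ∩ (connEvent ends a₁ a₂)ᶜ) ≤
    prob p (connEvent ends a₁ a₂)ᶜ *
      (prob p (connEvent ends a₂ b ∩ (connEvent ends a₁ o ∪ connEvent ends a₂ o) ∩
          (connEvent ends a₁ a₂)ᶜ) +
        prob p (connEvent ends a₁ b ∩ connEvent ends a₁ o ∩ (connEvent ends a₁ a₂)ᶜ))

/-- `{b ∈ C₂} ∩ {o ∈ U} ∩ Q` and `{b ∈ C₁} ∩ {o ∈ C₁} ∩ Q` are disjoint (on `Q`, `b` is not in both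
clusters) and both lie in `{o ∈ U} ∩ {b ∈ U} ∩ Q`. -/
lemma e1_pieces_le (p : E → R) (hp : IsProbVec p) (ends : E → Sym2 V) (a₁ a₂ o b : V) :
    prob p (connEvent ends a₂ b ∩ (connEvent ends a₁ o ∪ connEvent ends a₂ o) ∩
        (connEvent ends a₁ a₂)ᶜ) +
      prob p (connEvent ends a₁ b ∩ connEvent ends a₁ o ∩ (connEvent ends a₁ a₂)ᶜ) ≤
    prob p ((connEvent ends a₁ o ∪ connEvent ends a₂ o) ∩
      (connEvent ends a₁ b ∪ connEvent ends a₂ b) ∩ (connEvent ends a₁ a₂)ᶜ) := by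
  have hdisj : Disjoint (connEvent ends a₂ b ∩ (connEvent ends a₁ o ∪ connEvent ends a₂ o) ∩
      (connEvent ends a₁ a₂)ᶜ) (connEvent ends a₁ b ∩ connEvent ends a₁ o ∩ (connEvent ends a₁ a₂)ᶜ) := by
    rw [Set.disjoint_left]
    rintro ω ⟨⟨hb2, -⟩, hQ⟩ ⟨⟨hb1, -⟩, -⟩
    exact hQ (conn_trans hb1 (conn_symm hb2))
  rw [← prob_union_of_disjoint p hdisj]
  refine prob_mono hp ?_
  rintro ω (⟨⟨hb, ho⟩, hQ⟩ | ⟨⟨hb, ho⟩, hQ⟩)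
  · exact ⟨⟨ho, Or.inr hb⟩, hQ⟩
  · exact ⟨⟨Or.inl ho, Or.inl hb⟩, hQ⟩

/-- **Row 2′C1 from (E1)**: `E1Cov` gives `P(Q, b ∈ C₂)·P(Q, o ∈ U) ≤ P(Q)·P(Q, o ∈ U, b ∈ U)`. -/
theorem c1_of_e1 (p : E → R) (hp : IsProbVec p) (ends : E → Sym2 V) (a₁ a₂ o b : V)
    (h : E1Cov p ends a₁ a₂ o b) :
    prob p (connEvent ends a₂ b ∩ (connEvent ends a₁ a₂)ᶜ) *
      prob p ((connEvent ends a₁ o ∪ connEvent ends a₂ o) ∩ (connEvent ends a₁ a₂)ᶜ) ≤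
    prob p (connEvent ends a₁ a₂)ᶜ *
      prob p ((connEvent ends a₁ o ∪ connEvent ends a₂ o) ∩
        (connEvent ends a₁ b ∪ connEvent ends a₂ b) ∩ (connEvent ends a₁ a₂)ᶜ) := by
  unfold E1Cov at h
  exact h.trans (mul_le_mul_of_nonneg_left (e1_pieces_le p hp ends a₁ a₂ o b)
    (prob_nonneg hp (connEvent ends a₁ a₂)ᶜ))

end E1

end RowC1

end Summit.Ventures.PercRepro2
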